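import Summits.Ventures.YMGap.RobustBall.FourPointDecayS
import Literature.MathematicalPhysics.QuantumFieldTheory.Balaban1983to89.Beta.CrossTermBounds
import HarnessLib

/-!
# Venture YMGap, track ROBUST-BALL (Y2) — TIER 2: THE FOURTH CUMULANT OF A LOCAL OBSERVABLE AGAINST THREE PIECES OF A DIRECTION — TERMWISE MAJORANT

HONEST FRAMING. WHAT THIS IS: a venture file (cell `pub-ymgap`, track Y2 ROBUST-BALL, seat rb-p1, theorems only): the bookkeeping form of the tree decay of
`FourPointDecayS` for the third-order susceptibility.  Member `W ∈ MemBallZdS a Λ_t t` in the pair door (`t > 0`), ANY DLR `μ`; `F` local (on `Λ_F`, vector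
`δ_F`); ONE direction `V` of the ball (own-link terms `V_X` depending on `X`, Frobenius-Lipschitz witnesses `lipV_X`, loads `L_X = Σ_{y∈X} lipV_X(y)`):
* `fourPoint_sub_const_right`, `fourPoint_rotate`, `fourPoint_centre` — the fourth cumulant (ds-1's derivative form) is invariant under centring every slot
  (bounded measurable observables, probability measure) [folklore];
* ★★ `abs_fourPoint_le_majorant_S` — for all `X, Y, Z`:
  `|u₄(F; V_X; V_Y; V_Z)| ≤ 4608 N² S_f L_X L_Y L_Z Σ_{T} Π_{(P→C) ∈ T} G_P(C)`, the sum over the 16 spanning trees `T` of the four supports rooted at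
  `Λ_F`, every tree edge oriented away from the root and dominated by the link sum `G_P(C) = Σ_{e∈C} e^{−s·dist(P, e)}` (`s = t/3`) — ONE majorant for every
  member of the ball and every DLR state, ready to be summed over `X, Y, Z` with per-link loads (successor file).
WHAT THIS IS NOT: one-sided Dobrushin-comparison constants; the summation over `X, Y, Z` and `C³` of the state map are successor work; nothing continuum / Clay.
-/

noncomputable section

open MeasureTheory Function Finset ProbabilityTheory Real
open scoped NNReal
open Literature.Probability.LatticeModels
open Literature.Probability.LatticeModels.DobrushinMetric
open Literature.MathematicalPhysics.QuantumLattice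
open Literature.MathematicalPhysics.QuantumFieldTheory hiding ZdEdge

open Literature.MathematicalPhysics.QuantumFieldTheory.Balaban1983to89.Beta.CrossTermBounds (mul_three_le)

namespace Summit.Ventures.YMGap.RobustBall

variable {d N : ℕ}

/-- Local shorthand: the connected three-point function `u₃(X; Y; Z)` under `μ`. -/
local notation3 (prettyPrint := false) "U₃[" X ";" Y ";" Z ";" μ "]" =>
  cov[fun ω => X ω * Y ω, Z; μ] - (∫ ω, X ω ∂μ) * cov[Y, Z; μ] - (∫ ω, Y ω ∂μ) * cov[X, Z; μ]

/-- Local shorthand: the connected four-point function in derivative form `u₄(X; Y; Z; W)` under `μ`. -/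
local notation3 (prettyPrint := false) "U₄[" X ";" Y ";" Z ";" W' ";" μ "]" =>
  (cov[fun ω => (X ω * Y ω) * Z ω, W'; μ] - (∫ ω, X ω * Y ω ∂μ) * cov[Z, W'; μ] - (∫ ω, Z ω ∂μ) * cov[fun ω => X ω * Y ω, W'; μ])
  - cov[X, W'; μ] * cov[Y, Z; μ] - (∫ ω, X ω ∂μ) * U₃[Y ; Z ; W' ; μ]
  - cov[Y, W'; μ] * cov[X, Z; μ] - (∫ ω, Y ω ∂μ) * U₃[X ; Z ; W' ; μ]

/-! ### Centring the fourth cumulant -/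

section Centre

variable {Ω : Type*} [MeasurableSpace Ω] {μ : Measure Ω} [IsProbabilityMeasure μ] {X Y Z W : Ω → ℝ} {A B C D : ℝ}

/-- Bounded measurable functions on a probability space are integrable. -/
theorem integrable_of_abs_le_S (hX : Measurable X) (hA : ∀ ω, |X ω| ≤ A) : Integrable X μ :=
  (MemLp.of_bound hX.aestronglyMeasurable A (Filter.Eventually.of_forall fun ω => by
    rw [Real.norm_eq_abs]; exact hA ω)).integrable one_le_two

/-- **The fourth cumulant is invariant under a constant shift of its last argument.** [folklore] -/
theorem fourPoint_sub_const_right (hW : Measurable W) (hD : ∀ ω, |W ω| ≤ D) (r : ℝ) :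
    U₄[X ; Y ; Z ; fun ω => W ω - r ; μ] = U₄[X ; Y ; Z ; W ; μ] := by
  have hWi : Integrable W μ := integrable_of_abs_le_S hW hD
  simp only [covariance_sub_const_right hWi]

/-- **Cyclic symmetry** `u₄(X; Y; Z; W) = u₄(Y; Z; W; X)` (from the three transpositions of `ConnectedFourPointAlgebra`). [folklore] -/
theorem fourPoint_rotate (hX : Measurable X) (hY : Measurable Y) (hZ : Measurable Z) (hW : Measurable W)
    (hA : ∀ ω, |X ω| ≤ A) (hB : ∀ ω, |Y ω| ≤ B) (hC : ∀ ω, |Z ω| ≤ C) (hD : ∀ ω, |W ω| ≤ D) :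
    U₄[X ; Y ; Z ; W ; μ] = U₄[Y ; Z ; W ; X ; μ] := by
  rw [CouplingResponse.fourPoint_swap_xy hX hY hZ hW hA hB hC hD, CouplingResponse.fourPoint_swap_yz hY hX hZ hW hB hA hC hD,
    CouplingResponse.fourPoint_swap_zw hY hZ hX hW hB hC hA hD]

/-- **Centring every slot**: `u₄(X − a; Y − b; Z − c; W − r) = u₄(X; Y; Z; W)` for bounded measurable observables. [folklore] -/
theorem fourPoint_centre (hX : Measurable X) (hY : Measurable Y) (hZ : Measurable Z) (hW : Measurable W)
    (hA : ∀ ω, |X ω| ≤ A) (hB : ∀ ω, |Y ω| ≤ B) (hC : ∀ ω, |Z ω| ≤ C) (hD : ∀ ω, |W ω| ≤ D) (a b c r : ℝ) :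
    U₄[fun ω => X ω - a ; fun ω => Y ω - b ; fun ω => Z ω - c ; fun ω => W ω - r ; μ] = U₄[X ; Y ; Z ; W ; μ] := by
  have hb' : ∀ {T : Ω → ℝ} {M : ℝ} (q : ℝ), (∀ ω, |T ω| ≤ M) → ∀ ω, |T ω - q| ≤ M + |q| :=
    fun q hT ω => (abs_sub _ _).trans (add_le_add (hT ω) le_rfl)
  have hXm : Measurable fun ω => X ω - a := hX.sub measurable_const
  have hYm : Measurable fun ω => Y ω - b := hY.sub measurable_const
  have hZm : Measurable fun ω => Z ω - c := hZ.sub measurable_const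
  have hWm : Measurable fun ω => W ω - r := hW.sub measurable_const
  have hA' := hb' a hA; have hB' := hb' b hB; have hC' := hb' c hC; have hD' := hb' r hD
  symm
  rw [← fourPoint_sub_const_right (X := X) (Y := Y) (Z := Z) hW hD r, fourPoint_rotate hX hY hZ hWm hA hB hC hD',
    ← fourPoint_sub_const_right (X := Y) (Y := Z) (Z := fun ω => W ω - r) hX hA a, fourPoint_rotate hY hZ hWm hXm hB hC hD' hA',
    ← fourPoint_sub_const_right (X := Z) (Y := fun ω => W ω - r) (Z := fun ω => X ω - a) hY hB b,
    fourPoint_rotate hZ hWm hXm hYm hC hD' hA' hB',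
    ← fourPoint_sub_const_right (X := fun ω => W ω - r) (Y := fun ω => X ω - a) (Z := fun ω => Y ω - b) hZ hC c,
    fourPoint_rotate hWm hXm hYm hZm hD' hA' hB' hC']

end Centre

/-! ### The majorant -/

section SUN

variable {W V : Potential (ZdEdge d) (Matrix.specialUnitaryGroup (Fin N) ℂ)}

/-- ★★ **Termwise majorant of the fourth cumulant against three pieces of one direction (bookkeeping form).**  Member `W ∈ MemBallZdS a Λ_t t` in the
pair door (`t > 0`), ANY DLR `μ`; `F` local (on `Λ_F`, vector `δ_F`, bounded); direction `V` with measurable bounded own-link terms depending on their own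
set and Frobenius-Lipschitz witnesses `lipV`.  With `s = t/3`, `S_f = Σδ_F`, `L_X = Σ_{y∈X} lipV_X(y)`, `g_Δ(e) = e^{−s·dist(Δ,e)}` (passed as equations) and
`G_P(C) = Σ_{e∈C} g_P(e)`, for all `X, Y, Z`:
`|u₄(F; V_X; V_Y; V_Z)| ≤ 4608 N² S_f · L_X L_Y L_Z · Σ_{16 trees} Π_{edges (P→C)} G_P(C)` (every spanning tree of `{Λ_F, X, Y, Z}` rooted at `Λ_F`,
edges oriented away from the root) — `abs_fourPoint_le_tree_S` after centring all four slots, every tree exponential dominated by a link sum. -/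
theorem abs_fourPoint_le_majorant_S (hd : 1 ≤ d) (hN : 1 ≤ N) {β b c v a Λt t : ℝ}
    (hc : 0 ≤ c) (hv : 0 ≤ v) (hb : |β| * (2 * ((d : ℝ) - 1)) ≤ b)
    (hP : ∀ B : Matrix (Fin N) (Fin N) ℂ, matrixOpNorm B ≤ b →
      ∀ (ψ : Matrix.specialUnitaryGroup (Fin N) ℂ → ℝ) (M : ℝ), 0 ≤ M →
        (∀ x y, |ψ x - ψ y| ≤ M * suFrobDist x y) →
        Var[ψ; (haarProbability (Matrix.specialUnitaryGroup (Fin N) ℂ)).tilted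
          fun g => (N : ℝ) * ((g : Matrix (Fin N) (Fin N) ℂ) * B).trace.re] ≤ c * M ^ 2)
    (hVB : ∀ B : Matrix (Fin N) (Fin N) ℂ, matrixOpNorm B ≤ b → ∀ Δ : Matrix (Fin N) (Fin N) ℂ,
      Var[fun g : Matrix.specialUnitaryGroup (Fin N) ℂ =>
          (N : ℝ) * ((g : Matrix (Fin N) (Fin N) ℂ) * Δ).trace.re;
        (haarProbability (Matrix.specialUnitaryGroup (Fin N) ℂ)).tilted
          fun g => (N : ℝ) * ((g : Matrix (Fin N) (Fin N) ℂ) * B).trace.re] ≤ v * frobNorm Δ ^ 2)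
    (ht : 0 < t) (hρ : 6 * ((d : ℝ) - 1) * |β| * (exp a * exp t * Real.sqrt (c * v)) + exp (a / 2) * Real.sqrt c * Λt < 1)
    (hW : MemBallZdS a Λt t W) {μ : Measure (LGConfig d (Matrix.specialUnitaryGroup (Fin N) ℂ))}
    (hμ : μ ∈ perturbedGibbsMeasuresS (d := d) (fundamentalRep (Fin N)) (N * β) W)
    {F : LGConfig d (Matrix.specialUnitaryGroup (Fin N) ℂ) → ℝ} (hFm : Measurable F) {ΛF : Finset (ZdEdge d)}
    (hFdep : DependsOn F (↑ΛF : Set (ZdEdge d))) {MF : ℝ} (hMF : ∀ σ, |F σ| ≤ MF) {δF : ZdEdge d → ℝ} (hδF : IsLipBound suFrobDist F δF)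
    (hVm : ∀ X, Measurable (V X)) (hVdep : ∀ X, DependsOn (V X) (↑X : Set (ZdEdge d))) (hVb : ∀ X, ∃ C, ∀ U, |V X U| ≤ C)
    {lipV : Finset (ZdEdge d) → ZdEdge d → ℝ} (hlipV : ∀ X, IsLipBound suFrobDist (V X) (lipV X))
    {s : ℝ} (hs : s = t / 3) {Sf : ℝ} (hSf : Sf = ∑ y ∈ ΛF, δF y)
    {LX : Finset (ZdEdge d) → ℝ} (hLX : LX = fun X => ∑ y ∈ X, lipV X y)
    {gD : Finset (ZdEdge d) → ZdEdge d → ℝ} (hgD : gD = fun Δ e => exp (-s * linkSetDist Δ e)) (X Y Z : Finset (ZdEdge d)) :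
    |U₄[F ; V X ; V Y ; V Z ; μ]| ≤
      4608 * N ^ 2 * Sf * (LX X * LX Y * LX Z *
        ((∑ e ∈ X, gD ΛF e) * (∑ e ∈ Y, gD ΛF e) * (∑ e ∈ Z, gD ΛF e) +
        (∑ e ∈ X, gD ΛF e) * (∑ e ∈ Y, gD X e) * (∑ e ∈ Z, gD X e) +
        (∑ e ∈ Y, gD ΛF e) * (∑ e ∈ X, gD Y e) * (∑ e ∈ Z, gD Y e) +
        (∑ e ∈ Z, gD ΛF e) * (∑ e ∈ X, gD Z e) * (∑ e ∈ Y, gD Z e) +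
        (∑ e ∈ X, gD ΛF e) * (∑ e ∈ Y, gD X e) * (∑ e ∈ Z, gD Y e) +
        (∑ e ∈ X, gD ΛF e) * (∑ e ∈ Z, gD X e) * (∑ e ∈ Y, gD Z e) +
        (∑ e ∈ Y, gD ΛF e) * (∑ e ∈ X, gD Y e) * (∑ e ∈ Z, gD X e) +
        (∑ e ∈ Y, gD ΛF e) * (∑ e ∈ Z, gD Y e) * (∑ e ∈ X, gD Z e) +
        (∑ e ∈ Z, gD ΛF e) * (∑ e ∈ X, gD Z e) * (∑ e ∈ Y, gD X e) +
        (∑ e ∈ Z, gD ΛF e) * (∑ e ∈ Y, gD Z e) * (∑ e ∈ X, gD Y e) +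
        (∑ e ∈ X, gD ΛF e) * (∑ e ∈ Y, gD ΛF e) * (∑ e ∈ Z, gD Y e) +
        (∑ e ∈ X, gD ΛF e) * (∑ e ∈ Z, gD ΛF e) * (∑ e ∈ Y, gD Z e) +
        (∑ e ∈ Y, gD ΛF e) * (∑ e ∈ X, gD ΛF e) * (∑ e ∈ Z, gD X e) +
        (∑ e ∈ Y, gD ΛF e) * (∑ e ∈ Z, gD ΛF e) * (∑ e ∈ X, gD Z e) +
        (∑ e ∈ Z, gD ΛF e) * (∑ e ∈ X, gD ΛF e) * (∑ e ∈ Y, gD X e) +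
        (∑ e ∈ Z, gD ΛF e) * (∑ e ∈ Y, gD ΛF e) * (∑ e ∈ X, gD Y e))) := by
  classical
  have hμP : IsGibbsMeasure (perturbedYMS (d := d) (fundamentalRep (Fin N)) (N * β) W) μ := hμ
  haveI := hμP.isProbabilityMeasure
  have hSf0 : 0 ≤ Sf := hSf ▸ sum_nonneg fun y _ => hδF.nonneg y
  have hLX0 : ∀ X, 0 ≤ LX X := fun X => by rw [hLX]; exact sum_nonneg fun y _ => (hlipV X).nonneg y
  have hgD0 : ∀ Δ e, 0 ≤ gD Δ e := fun Δ e => by rw [hgD]; exact (exp_pos _).le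
  have hG0 : ∀ P C : Finset (ZdEdge d), 0 ≤ ∑ e ∈ C, gD P e := fun P C => sum_nonneg fun e _ => hgD0 P e
  have hNN : (0 : ℝ) ≤ N := Nat.cast_nonneg N
  have hs0 : 0 < s := by rw [hs]; positivity
  -- conversion of a set distance into a link sum, in either orientation
  have hconv : ∀ {P C : Finset (ZdEdge d)}, P.Nonempty → C.Nonempty → exp (-(s * setDistEdges P C)) ≤ ∑ e ∈ C, gD P e := by
    intro P C hP0 hC0
    obtain ⟨u, hu, w, hw, heq⟩ := exists_setDistEdges_eq hP0 hC0
    have h1 : linkSetDist P w ≤ ‖u.1 - w.1‖ := by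
      unfold linkSetDist; rw [dif_pos hP0, norm_sub_rev]; exact Finset.inf'_le _ hu
    rw [hgD]
    calc exp (-(s * setDistEdges P C)) ≤ exp (-s * linkSetDist P w) := exp_le_exp.2 (by rw [heq]; nlinarith)
      _ ≤ ∑ e ∈ C, exp (-s * linkSetDist P e) := single_le_sum (f := fun e => exp (-s * linkSetDist P e)) (fun e _ => (exp_pos _).le) hw
  have hconv' : ∀ {P C : Finset (ZdEdge d)}, P.Nonempty → C.Nonempty → exp (-(s * setDistEdges C P)) ≤ ∑ e ∈ C, gD P e :=
    fun hP0 hC0 => by rw [setDistEdges_comm]; exact hconv hP0 hC0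
  -- centring
  have hcentre : ∀ {h : LGConfig d (Matrix.specialUnitaryGroup (Fin N) ℂ) → ℝ} {Δ : Finset (ZdEdge d)} {δ : ZdEdge d → ℝ},
      DependsOn h (↑Δ : Set (ZdEdge d)) → IsLipBound suFrobDist h δ →
      (DependsOn (fun σ => h σ - h 1) (↑Δ : Set (ZdEdge d))) ∧ IsLipBound suFrobDist (fun σ => h σ - h 1) δ ∧
        ∀ σ, |h σ - h 1| ≤ 2 * Real.sqrt N * ∑ y ∈ Δ, δ y := by
    intro h Δ δ hdep hδ
    refine ⟨fun σ τ hστ => by simp only [hdep hστ], ⟨hδ.nonneg, fun y σ τ hστ => by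
      simpa only [sub_sub_sub_cancel_right] using hδ.le y σ τ hστ⟩, fun σ => ?_⟩
    calc |h σ - h 1| ≤ ∑ y ∈ Δ, δ y * suFrobDist (σ y) ((1 : LGConfig d (Matrix.specialUnitaryGroup (Fin N) ℂ)) y) :=
          abs_sub_le_sum_of_dependsOn hdep hδ σ 1
      _ ≤ ∑ y ∈ Δ, δ y * (2 * Real.sqrt N) := sum_le_sum fun y _ => mul_le_mul_of_nonneg_left (suFrobDist_le _ _) (hδ.nonneg y)
      _ = 2 * Real.sqrt N * ∑ y ∈ Δ, δ y := by rw [← sum_mul]; ring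
  obtain ⟨hF₁dep, hF₁lip, hF₁b⟩ := hcentre hFdep hδF
  obtain ⟨hX₁dep, hX₁lip, hX₁b⟩ := hcentre (hVdep X) (hlipV X)
  obtain ⟨hY₁dep, hY₁lip, hY₁b⟩ := hcentre (hVdep Y) (hlipV Y)
  obtain ⟨hZ₁dep, hZ₁lip, hZ₁b⟩ := hcentre (hVdep Z) (hlipV Z)
  have hF₁m : Measurable fun σ => F σ - F 1 := hFm.sub measurable_const
  have hX₁m : Measurable fun σ => V X σ - V X 1 := (hVm X).sub measurable_const
  have hY₁m : Measurable fun σ => V Y σ - V Y 1 := (hVm Y).sub measurable_const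
  have hZ₁m : Measurable fun σ => V Z σ - V Z 1 := (hVm Z).sub measurable_const
  obtain ⟨CX, hCX⟩ := hVb X
  obtain ⟨CY, hCY⟩ := hVb Y
  obtain ⟨CZ, hCZ⟩ := hVb Z
  rw [← fourPoint_centre hFm (hVm X) (hVm Y) (hVm Z) hMF hCX hCY hCZ (F 1) (V X 1) (V Y 1) (V Z 1)]
  have h1 := abs_fourPoint_le_tree_S hd hN hc hv hb hP hVB ht.le hρ hW hμ hF₁m hF₁dep hF₁b hF₁lip hX₁m hX₁dep hX₁b hX₁lip
    hY₁m hY₁dep hY₁b hY₁lip hZ₁m hZ₁dep hZ₁b hZ₁lip hSf (show LX X = ∑ y ∈ X, lipV X y by rw [hLX])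
    (show LX Y = ∑ y ∈ Y, lipV Y y by rw [hLX]) (show LX Z = ∑ y ∈ Z, lipV Z y by rw [hLX])
  rw [← hs, ← hSf, show (∑ y ∈ X, lipV X y) = LX X by rw [hLX], show (∑ y ∈ Y, lipV Y y) = LX Y by rw [hLX],
    show (∑ y ∈ Z, lipV Z y) = LX Z by rw [hLX]] at h1
  refine h1.trans ?_
  have hNsq : Real.sqrt N * Real.sqrt N = N := Real.mul_self_sqrt hNN
  have hcoef : 48 * (N : ℝ) * (((2 * Real.sqrt N * Sf) * (2 * Real.sqrt N * LX X) * LX Y + (2 * Real.sqrt N * Sf) * (2 * Real.sqrt N * LX Y) * LX X +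
          (2 * Real.sqrt N * LX X) * (2 * Real.sqrt N * LX Y) * Sf) * LX Z +
        ((2 * Real.sqrt N * Sf) * (2 * Real.sqrt N * LX X) * LX Z + (2 * Real.sqrt N * Sf) * (2 * Real.sqrt N * LX Z) * LX X +
          (2 * Real.sqrt N * LX X) * (2 * Real.sqrt N * LX Z) * Sf) * LX Y +
        ((2 * Real.sqrt N * Sf) * (2 * Real.sqrt N * LX Y) * LX Z + (2 * Real.sqrt N * Sf) * (2 * Real.sqrt N * LX Z) * LX Y +
          (2 * Real.sqrt N * LX Y) * (2 * Real.sqrt N * LX Z) * Sf) * LX X +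
        ((2 * Real.sqrt N * LX X) * (2 * Real.sqrt N * LX Y) * LX Z + (2 * Real.sqrt N * LX X) * (2 * Real.sqrt N * LX Z) * LX Y +
          (2 * Real.sqrt N * LX Y) * (2 * Real.sqrt N * LX Z) * LX X) * Sf +
        ((2 * Real.sqrt N * Sf) * LX X + (2 * Real.sqrt N * LX X) * Sf) * ((2 * Real.sqrt N * LX Y) * LX Z + (2 * Real.sqrt N * LX Z) * LX Y) +
        ((2 * Real.sqrt N * Sf) * LX Y + (2 * Real.sqrt N * LX Y) * Sf) * ((2 * Real.sqrt N * LX X) * LX Z + (2 * Real.sqrt N * LX Z) * LX X) +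
        ((2 * Real.sqrt N * Sf) * LX Z + (2 * Real.sqrt N * LX Z) * Sf) * ((2 * Real.sqrt N * LX X) * LX Y + (2 * Real.sqrt N * LX Y) * LX X)) =
      4608 * N ^ 2 * Sf * (LX X * LX Y * LX Z) := by linear_combination (4608 * N * Sf * LX X * LX Y * LX Z) * hNsq
  rw [hcoef]
  have hK0 : 0 ≤ 4608 * (N : ℝ) ^ 2 * Sf * (LX X * LX Y * LX Z) :=
    mul_nonneg (mul_nonneg (mul_nonneg (by norm_num) (pow_nonneg hNN 2)) hSf0) (mul_nonneg (mul_nonneg (hLX0 X) (hLX0 Y)) (hLX0 Z))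
  have hT0 : 0 ≤ (∑ e ∈ X, gD ΛF e) * (∑ e ∈ Y, gD ΛF e) * (∑ e ∈ Z, gD ΛF e) +
        (∑ e ∈ X, gD ΛF e) * (∑ e ∈ Y, gD X e) * (∑ e ∈ Z, gD X e) +
        (∑ e ∈ Y, gD ΛF e) * (∑ e ∈ X, gD Y e) * (∑ e ∈ Z, gD Y e) +
        (∑ e ∈ Z, gD ΛF e) * (∑ e ∈ X, gD Z e) * (∑ e ∈ Y, gD Z e) +
        (∑ e ∈ X, gD ΛF e) * (∑ e ∈ Y, gD X e) * (∑ e ∈ Z, gD Y e) +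
        (∑ e ∈ X, gD ΛF e) * (∑ e ∈ Z, gD X e) * (∑ e ∈ Y, gD Z e) +
        (∑ e ∈ Y, gD ΛF e) * (∑ e ∈ X, gD Y e) * (∑ e ∈ Z, gD X e) +
        (∑ e ∈ Y, gD ΛF e) * (∑ e ∈ Z, gD Y e) * (∑ e ∈ X, gD Z e) +
        (∑ e ∈ Z, gD ΛF e) * (∑ e ∈ X, gD Z e) * (∑ e ∈ Y, gD X e) +
        (∑ e ∈ Z, gD ΛF e) * (∑ e ∈ Y, gD Z e) * (∑ e ∈ X, gD Y e) +
        (∑ e ∈ X, gD ΛF e) * (∑ e ∈ Y, gD ΛF e) * (∑ e ∈ Z, gD Y e) +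
        (∑ e ∈ X, gD ΛF e) * (∑ e ∈ Z, gD ΛF e) * (∑ e ∈ Y, gD Z e) +
        (∑ e ∈ Y, gD ΛF e) * (∑ e ∈ X, gD ΛF e) * (∑ e ∈ Z, gD X e) +
        (∑ e ∈ Y, gD ΛF e) * (∑ e ∈ Z, gD ΛF e) * (∑ e ∈ X, gD Z e) +
        (∑ e ∈ Z, gD ΛF e) * (∑ e ∈ X, gD ΛF e) * (∑ e ∈ Y, gD X e) +
        (∑ e ∈ Z, gD ΛF e) * (∑ e ∈ Y, gD ΛF e) * (∑ e ∈ X, gD Y e) := by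
    refine add_nonneg ?_ (mul_nonneg (mul_nonneg (hG0 _ _) (hG0 _ _)) (hG0 _ _))
    refine add_nonneg ?_ (mul_nonneg (mul_nonneg (hG0 _ _) (hG0 _ _)) (hG0 _ _))
    refine add_nonneg ?_ (mul_nonneg (mul_nonneg (hG0 _ _) (hG0 _ _)) (hG0 _ _))
    refine add_nonneg ?_ (mul_nonneg (mul_nonneg (hG0 _ _) (hG0 _ _)) (hG0 _ _))
    refine add_nonneg ?_ (mul_nonneg (mul_nonneg (hG0 _ _) (hG0 _ _)) (hG0 _ _))
    refine add_nonneg ?_ (mul_nonneg (mul_nonneg (hG0 _ _) (hG0 _ _)) (hG0 _ _))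
    refine add_nonneg ?_ (mul_nonneg (mul_nonneg (hG0 _ _) (hG0 _ _)) (hG0 _ _))
    refine add_nonneg ?_ (mul_nonneg (mul_nonneg (hG0 _ _) (hG0 _ _)) (hG0 _ _))
    refine add_nonneg ?_ (mul_nonneg (mul_nonneg (hG0 _ _) (hG0 _ _)) (hG0 _ _))
    refine add_nonneg ?_ (mul_nonneg (mul_nonneg (hG0 _ _) (hG0 _ _)) (hG0 _ _))
    refine add_nonneg ?_ (mul_nonneg (mul_nonneg (hG0 _ _) (hG0 _ _)) (hG0 _ _))
    refine add_nonneg ?_ (mul_nonneg (mul_nonneg (hG0 _ _) (hG0 _ _)) (hG0 _ _))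
    refine add_nonneg ?_ (mul_nonneg (mul_nonneg (hG0 _ _) (hG0 _ _)) (hG0 _ _))
    refine add_nonneg ?_ (mul_nonneg (mul_nonneg (hG0 _ _) (hG0 _ _)) (hG0 _ _))
    refine add_nonneg ?_ (mul_nonneg (mul_nonneg (hG0 _ _) (hG0 _ _)) (hG0 _ _))
    exact mul_nonneg (mul_nonneg (hG0 _ _) (hG0 _ _)) (hG0 _ _)
  by_cases hne : ΛF.Nonempty ∧ X.Nonempty ∧ Y.Nonempty ∧ Z.Nonempty
  · obtain ⟨hF0, hX0, hY0, hZ0⟩ := hne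
    have htree : exp (-(s * setDistEdges ΛF X)) * exp (-(s * setDistEdges ΛF Y)) * exp (-(s * setDistEdges ΛF Z)) +
      exp (-(s * setDistEdges ΛF X)) * exp (-(s * setDistEdges X Y)) * exp (-(s * setDistEdges X Z)) +
      exp (-(s * setDistEdges ΛF Y)) * exp (-(s * setDistEdges X Y)) * exp (-(s * setDistEdges Y Z)) +
      exp (-(s * setDistEdges ΛF Z)) * exp (-(s * setDistEdges X Z)) * exp (-(s * setDistEdges Y Z)) +
      exp (-(s * setDistEdges ΛF X)) * exp (-(s * setDistEdges X Y)) * exp (-(s * setDistEdges Y Z)) +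
      exp (-(s * setDistEdges ΛF X)) * exp (-(s * setDistEdges X Z)) * exp (-(s * setDistEdges Y Z)) +
      exp (-(s * setDistEdges ΛF Y)) * exp (-(s * setDistEdges X Y)) * exp (-(s * setDistEdges X Z)) +
      exp (-(s * setDistEdges ΛF Y)) * exp (-(s * setDistEdges Y Z)) * exp (-(s * setDistEdges X Z)) +
      exp (-(s * setDistEdges ΛF Z)) * exp (-(s * setDistEdges X Z)) * exp (-(s * setDistEdges X Y)) +
      exp (-(s * setDistEdges ΛF Z)) * exp (-(s * setDistEdges Y Z)) * exp (-(s * setDistEdges X Y)) +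
      exp (-(s * setDistEdges ΛF X)) * exp (-(s * setDistEdges ΛF Y)) * exp (-(s * setDistEdges Y Z)) +
      exp (-(s * setDistEdges ΛF X)) * exp (-(s * setDistEdges ΛF Z)) * exp (-(s * setDistEdges Y Z)) +
      exp (-(s * setDistEdges ΛF Y)) * exp (-(s * setDistEdges ΛF X)) * exp (-(s * setDistEdges X Z)) +
      exp (-(s * setDistEdges ΛF Y)) * exp (-(s * setDistEdges ΛF Z)) * exp (-(s * setDistEdges X Z)) +
      exp (-(s * setDistEdges ΛF Z)) * exp (-(s * setDistEdges ΛF X)) * exp (-(s * setDistEdges X Y)) +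
      exp (-(s * setDistEdges ΛF Z)) * exp (-(s * setDistEdges ΛF Y)) * exp (-(s * setDistEdges X Y)) ≤
        (∑ e ∈ X, gD ΛF e) * (∑ e ∈ Y, gD ΛF e) * (∑ e ∈ Z, gD ΛF e) +
        (∑ e ∈ X, gD ΛF e) * (∑ e ∈ Y, gD X e) * (∑ e ∈ Z, gD X e) +
        (∑ e ∈ Y, gD ΛF e) * (∑ e ∈ X, gD Y e) * (∑ e ∈ Z, gD Y e) +
        (∑ e ∈ Z, gD ΛF e) * (∑ e ∈ X, gD Z e) * (∑ e ∈ Y, gD Z e) +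
        (∑ e ∈ X, gD ΛF e) * (∑ e ∈ Y, gD X e) * (∑ e ∈ Z, gD Y e) +
        (∑ e ∈ X, gD ΛF e) * (∑ e ∈ Z, gD X e) * (∑ e ∈ Y, gD Z e) +
        (∑ e ∈ Y, gD ΛF e) * (∑ e ∈ X, gD Y e) * (∑ e ∈ Z, gD X e) +
        (∑ e ∈ Y, gD ΛF e) * (∑ e ∈ Z, gD Y e) * (∑ e ∈ X, gD Z e) +
        (∑ e ∈ Z, gD ΛF e) * (∑ e ∈ X, gD Z e) * (∑ e ∈ Y, gD X e) +
        (∑ e ∈ Z, gD ΛF e) * (∑ e ∈ Y, gD Z e) * (∑ e ∈ X, gD Y e) +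
        (∑ e ∈ X, gD ΛF e) * (∑ e ∈ Y, gD ΛF e) * (∑ e ∈ Z, gD Y e) +
        (∑ e ∈ X, gD ΛF e) * (∑ e ∈ Z, gD ΛF e) * (∑ e ∈ Y, gD Z e) +
        (∑ e ∈ Y, gD ΛF e) * (∑ e ∈ X, gD ΛF e) * (∑ e ∈ Z, gD X e) +
        (∑ e ∈ Y, gD ΛF e) * (∑ e ∈ Z, gD ΛF e) * (∑ e ∈ X, gD Z e) +
        (∑ e ∈ Z, gD ΛF e) * (∑ e ∈ X, gD ΛF e) * (∑ e ∈ Y, gD X e) +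
        (∑ e ∈ Z, gD ΛF e) * (∑ e ∈ Y, gD ΛF e) * (∑ e ∈ X, gD Y e) := by
      refine add_le_add ?_ (mul_three_le (exp_pos _).le (exp_pos _).le (exp_pos _).le (hconv hF0 hZ0) (hconv hF0 hY0) (hconv' hY0 hX0))
      refine add_le_add ?_ (mul_three_le (exp_pos _).le (exp_pos _).le (exp_pos _).le (hconv hF0 hZ0) (hconv hF0 hX0) (hconv hX0 hY0))
      refine add_le_add ?_ (mul_three_le (exp_pos _).le (exp_pos _).le (exp_pos _).le (hconv hF0 hY0) (hconv hF0 hZ0) (hconv' hZ0 hX0))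
      refine add_le_add ?_ (mul_three_le (exp_pos _).le (exp_pos _).le (exp_pos _).le (hconv hF0 hY0) (hconv hF0 hX0) (hconv hX0 hZ0))
      refine add_le_add ?_ (mul_three_le (exp_pos _).le (exp_pos _).le (exp_pos _).le (hconv hF0 hX0) (hconv hF0 hZ0) (hconv' hZ0 hY0))
      refine add_le_add ?_ (mul_three_le (exp_pos _).le (exp_pos _).le (exp_pos _).le (hconv hF0 hX0) (hconv hF0 hY0) (hconv hY0 hZ0))
      refine add_le_add ?_ (mul_three_le (exp_pos _).le (exp_pos _).le (exp_pos _).le (hconv hF0 hZ0) (hconv' hZ0 hY0) (hconv' hY0 hX0))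
      refine add_le_add ?_ (mul_three_le (exp_pos _).le (exp_pos _).le (exp_pos _).le (hconv hF0 hZ0) (hconv' hZ0 hX0) (hconv hX0 hY0))
      refine add_le_add ?_ (mul_three_le (exp_pos _).le (exp_pos _).le (exp_pos _).le (hconv hF0 hY0) (hconv hY0 hZ0) (hconv' hZ0 hX0))
      refine add_le_add ?_ (mul_three_le (exp_pos _).le (exp_pos _).le (exp_pos _).le (hconv hF0 hY0) (hconv' hY0 hX0) (hconv hX0 hZ0))
      refine add_le_add ?_ (mul_three_le (exp_pos _).le (exp_pos _).le (exp_pos _).le (hconv hF0 hX0) (hconv hX0 hZ0) (hconv' hZ0 hY0))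
      refine add_le_add ?_ (mul_three_le (exp_pos _).le (exp_pos _).le (exp_pos _).le (hconv hF0 hX0) (hconv hX0 hY0) (hconv hY0 hZ0))
      refine add_le_add ?_ (mul_three_le (exp_pos _).le (exp_pos _).le (exp_pos _).le (hconv hF0 hZ0) (hconv' hZ0 hX0) (hconv' hZ0 hY0))
      refine add_le_add ?_ (mul_three_le (exp_pos _).le (exp_pos _).le (exp_pos _).le (hconv hF0 hY0) (hconv' hY0 hX0) (hconv hY0 hZ0))
      refine add_le_add ?_ (mul_three_le (exp_pos _).le (exp_pos _).le (exp_pos _).le (hconv hF0 hX0) (hconv hX0 hY0) (hconv hX0 hZ0))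
      exact mul_three_le (exp_pos _).le (exp_pos _).le (exp_pos _).le (hconv hF0 hX0) (hconv hF0 hY0) (hconv hF0 hZ0)
    calc 4608 * (N : ℝ) ^ 2 * Sf * (LX X * LX Y * LX Z) * _ ≤ 4608 * (N : ℝ) ^ 2 * Sf * (LX X * LX Y * LX Z) * _ :=
          mul_le_mul_of_nonneg_left htree hK0
      _ = _ := by ring
  · -- an empty support: the coefficient vanishes
    have h0 : Sf * (LX X * LX Y * LX Z) = 0 := by
      simp only [not_and_or, Finset.not_nonempty_iff_eq_empty] at hne
      rcases hne with h | h | h | h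
      · rw [hSf, h, sum_empty, zero_mul]
      · have h' : LX X = 0 := by rw [hLX]; simp [h]
        rw [h', zero_mul, zero_mul, mul_zero]
      · have h' : LX Y = 0 := by rw [hLX]; simp [h]
        rw [h', mul_zero, zero_mul, mul_zero]
      · have h' : LX Z = 0 := by rw [hLX]; simp [h]
        rw [h', mul_zero, mul_zero]
    have e1 : ∀ R : ℝ, 4608 * (N : ℝ) ^ 2 * Sf * (LX X * LX Y * LX Z) * R = 4608 * (N : ℝ) ^ 2 * (Sf * (LX X * LX Y * LX Z)) * R :=
      fun R => by ring
    have e2 : ∀ R : ℝ, 4608 * (N : ℝ) ^ 2 * Sf * (LX X * LX Y * LX Z * R) = 4608 * (N : ℝ) ^ 2 * (Sf * (LX X * LX Y * LX Z)) * R :=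
      fun R => by ring
    rw [e1, e2, h0]; simp

end SUN

end Summit.Ventures.YMGap.RobustBall

end
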